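import Summits.ValiantsHypothesis.ValiantsHypothesis.Theorems.AnyonJetsJetConstantElimIntegralMultipleTwoAdicFormalDegree
import HarnessLib

/-!
# AnyonJets — crux `JetConstantElimTwoAdic` (stmt-ValiantsHypothesis-23655), stub
# `∃ b₁, IntegralMultipleTwoAdicWith b₁`: formal degree of Bürgisser's integer skeleton

The formal-degree slice (`…IntegralMultipleTwoAdicFormalDegree`) bounds the 2-adic depth of the
multiplier by the formal degree of the SKELETON of the replacement circuit `Q'`. For circuits all
of whose gates have fan-in EXACTLY two (the normal form produced by the tree's
`ArithCircuit.exists_eq_formalDegree_le`, and Bürgisser's model) this is at most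
`(size Q' + 1) ×` the formal degree of `Q'` itself: each weighted sum `c u + d v ↦ Y u' + Y' v'`
adds one level. (Without the fan-in hypothesis the bound fails: zero-ary gates `Σ ∅` of formal
degree `0` can be summed and squared into skeleton gates of formal degree `2^j`.)

* `formalDegree_skeleton_le` — `fdeg (skeleton P) ≤ (size P + 1) · fdeg P` when every gate of `P`
  has exactly two operands.
* `integralMultipleTwoAdicWith_of_heightNormalFormFormalDegree'` — the capstone of
  `…TwoAdicFormalDegree` restated with "`Q'` has fan-in exactly two and `fdeg Q' ≤ X^a`"
  (exponent `5a + 12` unchanged).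

Route-independent imports; honest framing: bookkeeping; the stub, the crux and VP ≠ VNP stay open.
-/

noncomputable section

-- single-conjunct layout: Sub = Summit, duplicated namespace component intended
set_option linter.dupNamespace false

namespace Summit.ValiantsHypothesis.ValiantsHypothesis.Theorems.AnyonJets.JetConstantElim

open MvPolynomial Literature.Computability.AlgebraicComplexity
open Literature.Computability.AlgebraicComplexity.ArithCircuit
open Summit.ValiantsHypothesis.ValiantsHypothesis.Theorems.AnyonJets.ConstantFreeJetGrowth (jet)
open scoped BigOperators

section SkeletonFormalDegree

variable {k : Type*} [CommRing k] {σ : Type*}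

omit [CommRing k] in
/-- `gateFormalDegrees` of three more gates. [folklore] -/
theorem gateFormalDegrees_append_triple {τ : Type*} (gs : List (Gate ℤ τ)) (g₁ g₂ g₃ : Gate ℤ τ) :
    gateFormalDegrees (gs ++ [g₁, g₂, g₃]) =
      gateFormalDegrees gs ++ [g₁.formalDegree (gateFormalDegrees gs),
        g₂.formalDegree (gateFormalDegrees gs ++ [g₁.formalDegree (gateFormalDegrees gs)]),
        g₃.formalDegree (gateFormalDegrees gs ++ [g₁.formalDegree (gateFormalDegrees gs),
          g₂.formalDegree (gateFormalDegrees gs ++ [g₁.formalDegree (gateFormalDegrees gs)])])] := by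
  have h : gs ++ [g₁, g₂, g₃] = ((gs ++ [g₁]) ++ [g₂]) ++ [g₃] := by simp
  rw [h, gateFormalDegrees_append_singleton, gateFormalDegrees_append_singleton,
    gateFormalDegrees_append_singleton]
  simp

omit [CommRing k] in
/-- Formal degree of the skeleton of an operand against a skeleton formal-degree list `D'` of
length `≥ 3j` whose entries `3i+2`, `i < j`, are bounded by `(i+2) ·` the original formal degrees
`D` (length `j`): at most `(j+1) ·` the operand's original formal degree, which is `≥ 1`.
[folklore] -/
theorem formalDegree_skelOperand_le {M slot j : ℕ} {D : List ℕ} {D' : List ℕ} (hD : D.length = j)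
    (hD' : ∀ i, j ≤ i → D'.getD (3 * i + 2) 1 = 1)
    (hInv : ∀ i < j, 1 ≤ D.getD i 1 ∧ D'.getD (3 * i + 2) 1 ≤ (i + 2) * D.getD i 1)
    (u : Operand k σ) :
    1 ≤ u.formalDegree D ∧
      (skelOperand M slot u : Operand ℤ (σ ⊕ Fin (M + 1))).formalDegree D' ≤
        (j + 1) * u.formalDegree D := by
  cases u with
  | var i => simp [skelOperand, Operand.formalDegree]
  | const c => simp [skelOperand, Operand.formalDegree]
  | gate i =>
    simp only [skelOperand, Operand.formalDegree]
    rcases Nat.lt_or_ge i j with hij | hji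
    · obtain ⟨h1, h2⟩ := hInv i hij
      exact ⟨h1, h2.trans (Nat.mul_le_mul_right _ (by omega))⟩
    · rw [hD' i hji, List.getD_eq_default _ _ (by rw [hD]; exact hji)]
      omega

omit [CommRing k] in
/-- Appending at most two formal degrees to a skeleton list of length `3j` (junk entries `3i+2`,
`i ≥ j`, read as `1`) does not change the formal degree of a skeleton operand. [folklore] -/
theorem formalDegree_skelOperand_append {M slot j : ℕ} {D' : List ℕ} (hD'len : D'.length = 3 * j)
    (hD' : ∀ i, j ≤ i → D'.getD (3 * i + 2) 1 = 1) (extra : List ℕ) (hextra : extra.length ≤ 2)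
    (u : Operand k σ) :
    (skelOperand M slot u : Operand ℤ (σ ⊕ Fin (M + 1))).formalDegree (D' ++ extra) =
      (skelOperand M slot u : Operand ℤ (σ ⊕ Fin (M + 1))).formalDegree D' := by
  cases u with
  | var _ => rfl
  | const _ => rfl
  | gate i' =>
    simp only [skelOperand, Operand.formalDegree]
    rcases Nat.lt_or_ge i' j with hlt | hge
    · rw [List.getD_append _ _ _ _ (by rw [hD'len]; omega)]
    · rw [List.getD_eq_default _ _ (by simp [hD'len]; omega), hD' i' hge]

omit [CommRing k] in
/-- **`fdeg (skeleton P) ≤ (size P + 1) · fdeg P`** for circuits all of whose gates have exactly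
two operands. [folklore; Bürgisser 2009 §2.2] -/
theorem formalDegree_skeleton_le (P : ArithCircuit k σ) (h2 : ∀ g ∈ P.gates, g.fanIn = 2) :
    (skeleton P).formalDegree ≤ (P.size + 1) * P.formalDegree := by
  -- invariant along prefixes
  have inv : ∀ j ≤ P.size, ∀ i < j,
      1 ≤ (gateFormalDegrees (P.gates.take j)).getD i 1 ∧
      (gateFormalDegrees (skelGates (4 * P.size) 0 (P.gates.take j))).getD (3 * i + 2) 1 ≤
        (i + 2) * (gateFormalDegrees (P.gates.take j)).getD i 1 := by
    intro j
    induction j with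
    | zero => intro _ i hi; omega
    | succ j ih =>
      intro hj1 i hi
      have hjlt : j < P.gates.length := hj1
      have ih' := ih (Nat.le_of_succ_le hj1)
      have hD : (gateFormalDegrees (P.gates.take j)).length = j := by
        rw [gateFormalDegrees_length, List.length_take, Nat.min_eq_left hjlt.le]
      have hD'len : (gateFormalDegrees (skelGates (4 * P.size) 0 (P.gates.take j))).length = 3 * j := by
        rw [gateFormalDegrees_length, length_skelGates, List.length_take, Nat.min_eq_left hjlt.le]
      have hD' : ∀ i, j ≤ i →
          (gateFormalDegrees (skelGates (4 * P.size) 0 (P.gates.take j))).getD (3 * i + 2) 1 = 1 :=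
        fun i hi => List.getD_eq_default _ _ (by rw [hD'len]; omega)
      have hg2 : (P.gates[j]).fanIn = 2 := h2 _ (List.getElem_mem hjlt)
      -- the new triple
      obtain ⟨g₁, g₂, g₃, htriple⟩ := List.length_eq_three.mp (length_skelTriple (4 * P.size) j P.gates[j])
      have hskel : skelGates (4 * P.size) 0 (P.gates.take (j + 1)) =
          skelGates (4 * P.size) 0 (P.gates.take j) ++ [g₁, g₂, g₃] := by
        rw [List.take_succ_eq_append_getElem hjlt, skelGates_append, List.length_take,
          Nat.min_eq_left hjlt.le, Nat.zero_add, ← htriple]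
        simp [skelGates]
      have htakeD : gateFormalDegrees (P.gates.take (j + 1)) =
          gateFormalDegrees (P.gates.take j) ++
            [(P.gates[j]).formalDegree (gateFormalDegrees (P.gates.take j))] := by
        rw [List.take_succ_eq_append_getElem hjlt]
        exact gateFormalDegrees_append_singleton _ _
      rw [htakeD, hskel, gateFormalDegrees_append_triple]
      generalize hg_def : P.gates[j] = g at hg2 htriple ⊢
      generalize hDdef : gateFormalDegrees (P.gates.take j) = D at hD ih' ⊢
      generalize hD'def : gateFormalDegrees (skelGates (4 * P.size) 0 (P.gates.take j)) = D' at hD'len hD' ih' ⊢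
      have hop := fun (slot : ℕ) (u : Operand k σ) =>
        formalDegree_skelOperand_le (M := 4 * P.size) (slot := slot) hD hD' ih' u
      have happ := fun (slot : ℕ) (extra : List ℕ) (hextra : extra.length ≤ 2) (u : Operand k σ) =>
        formalDegree_skelOperand_append (M := 4 * P.size) (slot := slot) hD'len hD' extra hextra u
      -- earlier indices are untouched
      rcases Nat.lt_or_ge i j with hij | hji
      · rw [List.getD_append _ _ _ _ (by rw [hD]; exact hij),
          List.getD_append _ _ _ _ (by rw [hD'len]; omega)]
        exact ih' i hij
      obtain rfl : i = j := by omega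
      rw [List.getD_append_right _ _ _ _ (by rw [hD]),
        List.getD_append_right _ _ _ _ (by rw [hD'len]; omega)]
      simp only [hD, hD'len, Nat.sub_self, List.getD_cons_zero, show 3 * i + 2 - 3 * i = 2 by omega,
        List.getD_cons_succ]
      -- case analysis on the gate (fan-in exactly two)
      cases g with
      | sum args =>
        rcases args with _ | ⟨⟨a, u⟩, _ | ⟨⟨b, v⟩, _ | ⟨c, rest⟩⟩⟩ <;>
          simp [Gate.fanIn, Gate.args] at hg2
        simp only [skelTriple, List.cons.injEq, and_true] at htriple
        obtain ⟨rfl, rfl, rfl⟩ := htriple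
        obtain ⟨hu1, hu⟩ := hop (constSlot i 0) u
        obtain ⟨hv1, hv⟩ := hop (constSlot i 1) v
        have hfd : (Gate.sum [(a, u), (b, v)]).formalDegree D =
            max (u.formalDegree D) (max (v.formalDegree D) 0) := by simp [Gate.formalDegree]
        have h0 : (coefGate (4 * P.size) i 0 u : Gate ℤ (σ ⊕ Fin (4 * P.size + 1))).formalDegree D' =
            1 + (skelOperand (4 * P.size) (constSlot i 0) u :
              Operand ℤ (σ ⊕ Fin (4 * P.size + 1))).formalDegree D' := by
          simp [coefGate, Gate.formalDegree, Operand.formalDegree]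
        have h1 : ∀ x : ℕ, (coefGate (4 * P.size) i 1 v :
            Gate ℤ (σ ⊕ Fin (4 * P.size + 1))).formalDegree (D' ++ [x]) =
            1 + (skelOperand (4 * P.size) (constSlot i 1) v :
              Operand ℤ (σ ⊕ Fin (4 * P.size + 1))).formalDegree D' := by
          intro x
          rw [← happ (constSlot i 1) [x] (by simp) v]
          simp [coefGate, Gate.formalDegree, Operand.formalDegree]
        have h2' : ∀ x y : ℕ, (Gate.sum [((1 : ℤ), Operand.gate (3 * i)), (1, .gate (3 * i + 1))] :
            Gate ℤ (σ ⊕ Fin (4 * P.size + 1))).formalDegree (D' ++ [x, y]) = max x (max y 0) := by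
          intro x y
          simp only [Gate.formalDegree, List.map_cons, List.map_nil, List.foldr_cons, List.foldr_nil,
            Operand.formalDegree, List.getD_eq_getElem?_getD]
          rw [List.getElem?_append_right (by omega), List.getElem?_append_right (by omega), hD'len,
            Nat.sub_self, show 3 * i + 1 - 3 * i = 1 by omega]
          simp
        rw [h2', h1, h0, hfd]
        refine ⟨le_max_of_le_left hu1, ?_⟩
        have hm1 : 1 ≤ max (u.formalDegree D) (max (v.formalDegree D) 0) := le_max_of_le_left hu1
        have hmu : u.formalDegree D ≤ max (u.formalDegree D) (max (v.formalDegree D) 0) := le_max_left _ _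
        have hmv : v.formalDegree D ≤ max (u.formalDegree D) (max (v.formalDegree D) 0) :=
          (le_max_left _ _).trans (le_max_right _ _)
        generalize max (u.formalDegree D) (max (v.formalDegree D) 0) = m at hm1 hmu hmv ⊢
        have hA : (skelOperand (4 * P.size) (constSlot i 0) u :
            Operand ℤ (σ ⊕ Fin (4 * P.size + 1))).formalDegree D' ≤ (i + 1) * m :=
          hu.trans (Nat.mul_le_mul_left _ hmu)
        have hB : (skelOperand (4 * P.size) (constSlot i 1) v :
            Operand ℤ (σ ⊕ Fin (4 * P.size + 1))).formalDegree D' ≤ (i + 1) * m :=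
          hv.trans (Nat.mul_le_mul_left _ hmv)
        have hgoal : max (1 + (skelOperand (4 * P.size) (constSlot i 0) u :
            Operand ℤ (σ ⊕ Fin (4 * P.size + 1))).formalDegree D')
            (max (1 + (skelOperand (4 * P.size) (constSlot i 1) v :
              Operand ℤ (σ ⊕ Fin (4 * P.size + 1))).formalDegree D') 0) ≤ 1 + (i + 1) * m :=
          max_le (by omega) (max_le (by omega) (by omega))
        refine hgoal.trans ?_
        have : (i + 2) * m = (i + 1) * m + m := by ring
        omega
      | prod args =>
        rcases args with _ | ⟨u, _ | ⟨v, _ | ⟨c, rest⟩⟩⟩ <;>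
          simp [Gate.fanIn, Gate.args] at hg2
        simp only [skelTriple, List.cons.injEq, and_true] at htriple
        obtain ⟨rfl, rfl, rfl⟩ := htriple
        obtain ⟨hu1, hu⟩ := hop (constSlot i 0) u
        obtain ⟨hv1, hv⟩ := hop (constSlot i 1) v
        have hfd : (Gate.prod [u, v]).formalDegree D = u.formalDegree D + v.formalDegree D := by
          simp [Gate.formalDegree]
        have h3 : ∀ x y : ℕ, (Gate.prod [skelOperand (4 * P.size) (constSlot i 0) u,
            skelOperand (4 * P.size) (constSlot i 1) v] :
            Gate ℤ (σ ⊕ Fin (4 * P.size + 1))).formalDegree (D' ++ [x, y]) =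
            (skelOperand (4 * P.size) (constSlot i 0) u :
              Operand ℤ (σ ⊕ Fin (4 * P.size + 1))).formalDegree D' +
            (skelOperand (4 * P.size) (constSlot i 1) v :
              Operand ℤ (σ ⊕ Fin (4 * P.size + 1))).formalDegree D' := by
          intro x y
          rw [← happ (constSlot i 0) [x, y] (by simp) u, ← happ (constSlot i 1) [x, y] (by simp) v]
          simp [Gate.formalDegree]
        rw [h3, hfd]
        constructor
        · omega
        · nlinarith
  -- the output operand
  have hS : P.gates.take P.size = P.gates := List.take_length
  have hD : (gateFormalDegrees P.gates).length = P.size := gateFormalDegrees_length _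
  have hD'len : (gateFormalDegrees (skelGates (4 * P.size) 0 P.gates)).length = 3 * P.size := by
    rw [gateFormalDegrees_length, length_skelGates]; rfl
  have hfin := inv P.size le_rfl
  rw [hS] at hfin
  obtain ⟨-, hout⟩ := formalDegree_skelOperand_le (M := 4 * P.size) (slot := 4 * P.size) hD
    (fun i hi => List.getD_eq_default _ _ (by rw [hD'len]; omega)) hfin P.output
  exact hout

end SkeletonFormalDegree

/-- **`HNF₃'_a → IntegralMultipleTwoAdicWith (5a + 12)`**: the formal-degree capstone with the
hypothesis stated on the replacement circuit `Q'` itself — all gates of fan-in exactly two and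
`(size Q' + 1) · fdeg Q' ≤ X^a` (so `fdeg (skeleton Q') ≤ X^a` by `formalDegree_skeleton_le`).
[folklore] -/
theorem integralMultipleTwoAdicWith_of_heightNormalFormFormalDegree' (a : ℕ)
    (hHNF : ∀ n k : ℕ, k ≤ Nat.log 2 n →
      ∀ Q : ArithCircuit (AlgebraicClosure ℚ) (Fin n × Fin n), Q.IsFanInTwo →
        Q.Computes (MvPolynomial.map (Int.castRingHom (AlgebraicClosure ℚ)) (jet n k)) →
        ∃ (d : ℕ) (β : Fin (d + 1) → AlgebraicClosure ℚ)
          (γ : Fin (d + 1) → Fin (d + 1) → Fin (d + 1) → ℤ)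
          (Q' : ArithCircuit (AlgebraicClosure ℚ) (Fin n × Fin n)) (N h : ℕ)
          (P : Fin (4 * Q'.size + 1) → Fin (d + 1) → ℤ),
          β 0 = 1 ∧ LinearIndependent ℚ β ∧
          (∀ a b, β a * β b = ∑ l, (γ a b l : AlgebraicClosure ℚ) * β l) ∧
          (∀ g ∈ Q'.gates, g.fanIn = 2) ∧
          Q'.Computes (MvPolynomial.map (Int.castRingHom (AlgebraicClosure ℚ)) (jet n k)) ∧
          1 ≤ N ∧ N ≤ 2 ^ h ∧
          (∀ v : Fin (4 * Q'.size + 1),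
            (N : AlgebraicClosure ℚ) * slotConst Q' v = ∑ l, (P v l : AlgebraicClosure ℚ) * β l) ∧
          (∀ v l, (P v l).natAbs ≤ 2 ^ h) ∧ (∀ a b l, (γ a b l).natAbs ≤ 2 ^ h) ∧
          d + 1 ≤ (Q.size + n + 2) ^ a ∧ h ≤ (Q.size + n + 2) ^ a ∧
          Q'.size ≤ (Q.size + n + 2) ^ a ∧ (Q'.size + 1) * Q'.formalDegree ≤ (Q.size + n + 2) ^ a) :
    IntegralMultipleTwoAdicWith (5 * a + 12) := by
  refine integralMultipleTwoAdicWith_of_heightNormalFormFormalDegree a fun n k hk Q hQ2 hQc => ?_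
  obtain ⟨d, β, γ, Q', N, h, P, hβ0, hind, hβ, hQ'2, hQ'c, hN1, hNh, hP, hPh, hγh, hd, hh, hs, hfd⟩ :=
    hHNF n k hk Q hQ2 hQc
  exact ⟨d, β, γ, Q', N, h, P, hβ0, hind, hβ, fun g hg => (hQ'2 g hg).le, hQ'c, hN1, hNh, hP, hPh,
    hγh, hd, hh, hs, (formalDegree_skeleton_le Q' hQ'2).trans hfd⟩

end Summit.ValiantsHypothesis.ValiantsHypothesis.Theorems.AnyonJets.JetConstantElim

end
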